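import Summits.BirchSwinnertonDyer.BirchSwinnertonDyer.Theorems.PrintCf2SplitBadTwoProNullLevelLift
import Summits.BirchSwinnertonDyer.BirchSwinnertonDyer.Theorems.PrintCf2SplitBadTwoKummerDualAtVbar
import Summits.BirchSwinnertonDyer.BirchSwinnertonDyer.Theorems.PrintCf2SplitBadTwoKummerTowerProNullClasses
import Summits.BirchSwinnertonDyer.Rank1Residual.X11b.MaxUnramifiedRestriction
import HarnessLib

/-!
# Crux `PrintCf2.SplitBadTwoRankOneOfFacts` (stmt-BirchSwinnertonDyer-20368), S3n′-FACT-FREE road, brick R1′ proper: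
# (PRO-NULL) FOR THE TRIVIAL CYCLIC LEVELS (θ = 1) — the discharge of `ProNullLift`'s `hkill`

Cell `bsd-print-cf2`, WIDTH seat `bsd-line-cf2-p1-w7` g6 (prover-bsd-line-cf2-p1-w7-g6-0); `--supports
stmt-BirchSwinnertonDyer-20368` (helper, Theses-free). HONEST FRAMING: nothing here closes the crux or a registered stub;
BSD is not proved by any of this; no summit statement is proved by this seat. No definition, no named fact, no `sorry`.
UNCONDITIONAL (inputs: (R1) = p696581 via p697446, Leopoldt-at-`v` = Brumer–Baker in the kernel; (K-ū) p700084; the tree's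
Poitou–Tate local duality `LocalInvariants.canonical_isPerfect`).

WHAT (memo `Cruxes/SplitBadTwoRankOneOfFacts/S3N-FACTFREE-w2g14.md` §§2–4, §7). `-w5` g7's level-lifting surgery `ProNullLift.
exists_selmer_sub_localMap_mem_canonical_of_dualPullback_eq_zero` (p700098) takes ONE input beyond the tree's Poitou–Tate theorem:
**`hkill : ∀ y ∈ H¹_{𝓕^*}(F, M^D)[canonical], H¹(ι^D) y = 0`** for two levels `M₀ →ι M`. THIS FILE proves `hkill` for the TRIVIAL
CYCLIC levels `M₀ = ℤ/p^k`, `M = ℤ/p^M`, `ι(1) = p^{M−k}` (the levels of `A_θ = ℚ_p/ℤ_p(θ)`, `θ = 1`) over a finite ABELIAN extension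
`F` of an imaginary quadratic `K` with `p = v v̄` split, for `𝓕 = ⊤` above `v` and `H¹_ur` at every other finite place (the structure
`L*` of the memo), in Γ_F-currency (`F` a number field on its own, places `w : HeightOneSpectrum (𝓞 F)`):
* §1 `dvd_log_valuation_of_mem_dualLocalCondition_unramifiedSubgroup` — at `w` with `𝓕_w = H¹_ur(F_w, ℤ/n)`: `loc_w y ∈ (H¹_ur)^⊥`
  (canonical pairing) and `H¹(e) y = kummerMap F n a` (`e : Hom(ℤ/n, μ_n) → μ_n`, `f ↦ f 1`) give `(n : ℤ) ∣ log (w.valuation F a)`: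
  test class `t_χ = [χ]` of THE normalised unramified character of `F_w`; `canonical_w = invLevel ∘ H²(muLocalIso)`; naturality
  (`ContPairing.cupProduct_map`) along `(c ↦ c·id, f ↦ f 1, muLocalIso)` and graded commutativity (`cupProduct_comm`) turn
  `t_χ ∪ loc_w y` into `−(κ_n(a) ∪ [χ·id])`; then (K-ū) `cupProduct_δ₀_scalarCocycle_eq_zero_iff_dvd_ord` (p700084).
* §2 `localization_kummerMap_eq_zero_of_mem_dualLocalCondition_top` — at `w` with `𝓕_w = ⊤`: `⊤^⊥ = 0` (`canonical_isPerfect`).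
* §3 `map_tateDualComap_eq_zero_of_red_kummerMap_eq_zero` — the LEVEL SQUARE `e₀ ∘ H¹(ι^D) = H¹(μ_{p^M} ↠ μ_{p^k}) ∘ H¹(e)` with
  `e₀ : Hom(ℤ/p^k, μ_{p^M}) ⥲ μ_{p^k}` bijective: `H¹(ι^D) y = 0` once the transition kills `kummerMap F (p^M) a`.
* §4 **`proNull_canonical_of_trivial`** — assembly with p697446: `∀ k ∃ M ≥ k`, for all such `ρ₀, ρ, ι, 𝓕`,
  **`∀ y ∈ ((LocalInvariants.canonical F (p^M)).dualSelmerStructure ρ 𝓕).selmerGroup, galoisCohomology.map (tateDualComap ι) 1 y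
  = 0`** — `ProNullLift`'s `hkill`, letter for letter, for these levels.
beyond-print theorem: no (Kummer theory + local CFT + Leopoldt for abelian `F/K`, folklore given Brumer). presearch: NOTES.md.

References: Serre, *Galois Cohomology* II §1.2; Milne, *ADT* I §2, Thm. 4.10; Neukirch–Schmidt–Wingberg (1.4.2), (1.4.4);
de Shalit (1987) III.2.3; Greenberg, LNM 1716 Props. 4.13–4.15 (the pattern `SUR ⟸ Leopoldt`).
-/

noncomputable section

set_option linter.dupNamespace false
set_option autoImplicit false

open scoped Classical WithZero ContRepresentation
open NumberField IsDedekindDomain Field ValuativeRel Function CategoryTheory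
open _root_.ContinuousCohomology
open Literature.NumberTheory.GaloisRepresentations
open Literature.NumberTheory.GaloisRepresentations.DiscreteGaloisModule
open Literature.NumberTheory.GaloisRepresentations.LocalWeilDatum Literature.NumberTheory.GaloisRepresentations.IsNonarchimedeanLocalField
open Literature.NumberTheory.GaloisCohomology
open Literature.NumberTheory.EllipticCurves (IsImaginaryQuadratic)
open Literature.AnabelianGeometry.AbsoluteAnabelian Literature.AnabelianGeometry.AbsoluteAnabelian.Prop121vii
open Summit.BirchSwinnertonDyer.Rank1Residual.GaloisImage.Transport (tateDualComap tateDualComap_apply_apply)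
open Summit.BirchSwinnertonDyer.Rank1Residual.GaloisImage.CoreRankZero (localization_map_one_eq)


namespace Summit.BirchSwinnertonDyer.BirchSwinnertonDyer.Theorems.PrintCf2.KummerProNull

/-! ### §0 The evaluation map `Hom(ℤ/n, μ_n) → μ_n`, `f ↦ f 1`, for a trivial module on `ℤ/n` -/

section Eval

variable {F : Type} [Field F] {n : ℕ} [NeZero n]

/-- **`e : (ℤ/n)^D → μ_n`, `f ↦ f(1)`, is `Γ_F`-equivariant** when `Γ_F` acts trivially on `ℤ/n` (`(σ f)(1) = σ(f(σ⁻¹ 1)) =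
σ (f 1)`): there is a continuous intertwining map with this formula. [cite: MilneADT2006, Ch. I §2] -/
theorem exists_contIntertwiningMap_tateDual_eval (ρ : DiscreteGaloisModule F (ZMod n))
    (hρ : ∀ (σ : absoluteGaloisGroup F) (m : ZMod n), ρ σ m = m) :
    ∃ e : (ρ.tateDual n).toContRepresentation →ⁱL (mu F n).toContRepresentation, ∀ f, e f = f 1 := by
  refine ⟨{ toContinuousLinearMap := ⟨(tateDualEval F (ZMod n) n 1).toIntLinearMap, continuous_of_discreteTopology⟩
            isIntertwining' := fun σ ↦ ContinuousLinearMap.ext fun f ↦ ?_ }, fun f ↦ rfl⟩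
  change tateDualEval F (ZMod n) n 1 ((ρ.tateDual n) σ f) = mu F n σ (tateDualEval F (ZMod n) n 1 f)
  rw [tateDualEval_apply, tateDualEval_apply, tateDual_apply_apply_apply, hρ]

end Eval

/-! ### §1 At a place where `𝓕_w = H¹_ur`: the dual condition forces `n ∣ log v_w(a)` -/

section Unramified

variable (F : Type) [Field F] [NumberField F] {n : ℕ} [NeZero n]

/-- **The dual of the unramified condition at ANY finite place, read on Kummer classes.** Let `Γ_F` act trivially on `ℤ/n`
(`ρ`), `e : (ℤ/n)^D → μ_n` the evaluation `f ↦ f 1`, `y ∈ H¹(F, (ℤ/n)^D)` with `H¹(e) y = kummerMap F n a`. If at the finite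
place `w` the localisation `loc_w y` is orthogonal, under THE canonical local Tate pairing (`LocalInvariants.canonical`), to the
unramified classes `H¹_ur(F_w, ℤ/n)`, then `(n : ℤ) ∣ log (w.valuation F a)`. (Test class `t_χ = [χ]` of the normalised
unramified character; `canonical_w = inv_{F_w} ∘ H²(μ_n(F̄)| ≅ μ_n(F̄_w))`; naturality and graded commutativity of the cup
product; `inv_{F_w}(κ_n(a) ∪ [χ·id]) = ord_{F_w}(a)`.) [cite: SerreLocalFields1979, XIV §1 Prop. 3]
[cite: NeukirchSchmidtWingberg2008, I §4 (1.4.2), (1.4.4)] [cite: MilneADT2006, Ch. I §2 (Thm. 2.6)] -/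
theorem dvd_log_valuation_of_mem_dualLocalCondition_unramifiedSubgroup (ρ : DiscreteGaloisModule F (ZMod n))
    (hρ : ∀ (σ : absoluteGaloisGroup F) (m : ZMod n), ρ σ m = m)
    (e : (ρ.tateDual n).toContRepresentation →ⁱL (mu F n).toContRepresentation) (he : ∀ f, e f = f 1)
    (w : HeightOneSpectrum (𝓞 F)) (a : Fˣ) (y : galoisCohomology (ρ.tateDual n) 1)
    (hy : galoisCohomology.map e 1 y = Multiplicative.toAdd (kummerMap F n a))
    (hw : galoisCohomology.localization (ρ.tateDual n) (Sum.inr w) 1 y ∈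
      (LocalInvariants.canonical F n).dualLocalCondition ρ (Sum.inr w)
        (unramifiedSubgroup (GaloisRep.toLocal w ρ) 1)) :
    (n : ℤ) ∣ WithZero.log (w.valuation F (a : F)) := by
  haveI hcz : CharZero (w.adicCompletion F) := charZero_adicCompletion w
  haveI : NeZero ((n : ℕ) : w.adicCompletion F) := ⟨by exact_mod_cast NeZero.ne n⟩
  haveI : CompactSpace (absoluteGaloisGroup (Place.Completion (Sum.inr w : Place F))) := absoluteGaloisGroup_compactSpace _
  haveI : CompactSpace (absoluteGaloisGroup (w.adicCompletion F)) := absoluteGaloisGroup_compactSpace _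
  rcases Nat.lt_or_ge 1 n with hn1 | hn1
  swap
  · have hn : n = 1 := le_antisymm hn1 (NeZero.pos n)
    subst hn
    exact ⟨_, by rw [Nat.cast_one, one_mul]⟩
  obtain ⟨χ, hIχ, hFχ, -, -⟩ := exists_normalizedCharacter (w.adicCompletion F) n hn1
  -- the unramified test class `t_χ = [σ ↦ χ σ] ∈ H¹(F_w, ℤ/n)`
  let tχ : contOneCocycles (ρ.toLocal (Sum.inr w)).toTopRep :=
    ⟨⟨fun σ ↦ χ σ, χ.continuous⟩, fun σ τ ↦ by
      change χ (σ * τ) = χ σ + ρ (absGaloisRestrict F (w.adicCompletion F) σ) (χ τ)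
      exact (χ.map_mul σ τ).trans (congrArg (χ σ + ·) (hρ _ _).symm)⟩
  have htχ : oneCocycleClass _ tχ ∈ unramifiedSubgroup (GaloisRep.toLocal w ρ) 1 :=
    (Summit.BirchSwinnertonDyer.Rank1Residual.X11b.LocBridge.mem_unramifiedSubgroup_one_iff_forall_eq_zero
      (GaloisRep.toLocal w ρ) (fun τ _ m ↦ hρ _ m) tχ).mpr (fun τ hτ ↦ hIχ τ hτ)
  have hval := (LocalInvariants.mem_dualLocalCondition_iff _ _ _ _ _).mp hw _ htχ
  -- the three module maps along which the cup product is transported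
  let P₁ := tateDualPairingLocal ρ n (Sum.inr w)
  let P := (mu (w.adicCompletion F) n).tateDualPairing n
  let α : (ρ.toLocal (Sum.inr w)).toTopRep ⟶ ((mu (w.adicCompletion F) n).tateDual n).toTopRep :=
    TopRep.ofHom ⟨⟨(AddMonoidHom.mk' (scalarEnd (w.adicCompletion F) (n := n))
        (scalarEnd_add (w.adicCompletion F))).toIntLinearMap, continuous_of_discreteTopology⟩, fun σ ↦ by
      refine ContinuousLinearMap.ext fun x ↦ ?_
      change scalarEnd (w.adicCompletion F) (ρ (absGaloisRestrict F (w.adicCompletion F) σ) x) =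
        (mu (w.adicCompletion F) n).tateDual n σ (scalarEnd (w.adicCompletion F) x)
      rw [hρ, tateDual_scalarEnd]⟩
  let β : ((ρ.tateDual n).toLocal (Sum.inr w)).toTopRep ⟶ (mu (w.adicCompletion F) n).toTopRep :=
    TopRep.ofHom ⟨⟨((muTransfer F (w.adicCompletion F) n).comp (tateDualEval F (ZMod n) n 1)).toIntLinearMap,
        continuous_of_discreteTopology⟩, fun σ ↦ by
      refine ContinuousLinearMap.ext fun f ↦ ?_
      change muTransfer F (w.adicCompletion F) n
          (tateDualEval F (ZMod n) n 1 ((ρ.tateDual n) (absGaloisRestrict F (w.adicCompletion F) σ) f)) =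
        mu (w.adicCompletion F) n σ (muTransfer F (w.adicCompletion F) n (tateDualEval F (ZMod n) n 1 f))
      rw [tateDualEval_apply, tateDualEval_apply, tateDual_apply_apply_apply, hρ, muTransfer_mu]⟩
  have hc : ∀ (x : ZMod n) (f : TateDual F (ZMod n) n),
      (muLocalIso w n).hom.hom (P₁.toLin x f) = P.flip.toLin (α.hom x) (β.hom f) := by
    intro x f
    change muTransfer F (w.adicCompletion F) n (tateDualEval F (ZMod n) n x f) =
      tateDualEval (w.adicCompletion F) (MuCarrier (w.adicCompletion F) n) n
        (muTransfer F (w.adicCompletion F) n (tateDualEval F (ZMod n) n 1 f)) (scalarEnd (w.adicCompletion F) x)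
    rw [tateDualEval_apply, tateDualEval_apply, tateDualEval_apply, scalarEnd_apply]
    change muTransfer F (w.adicCompletion F) n (f x) = ((x.val : ℤ)) • muTransfer F (w.adicCompletion F) n (f 1)
    have hfx : f x = x.val • f 1 := by
      conv_lhs => rw [← ZMod.natCast_zmod_val x, ← nsmul_one]
      exact map_nsmul f x.val 1
    rw [hfx, natCast_zsmul]
    exact map_nsmul (muTransfer F (w.adicCompletion F) n) x.val (f 1)
  -- naturality: `H²(muLocalIso)(t_χ ∪ loc_w y) = H¹(α) t_χ ∪' H¹(β) loc_w y` for the flipped pairing `∪'`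
  have hnat := ContPairing.cupProduct_map P₁ P.flip α β (muLocalIso w n).hom hc (oneCocycleClass _ tχ)
    (galoisCohomology.localization (ρ.tateDual n) (Sum.inr w) 1 y)
  have hα : cohomologyMap α 1 (oneCocycleClass _ tχ) = oneCocycleClass _ (scalarCocycle χ) := by
    rw [cohomologyMap_oneCocycleClass]
    exact congrArg _ (Subtype.ext (ContinuousMap.ext fun σ ↦ rfl))
  have ha0 : algebraMap F (w.adicCompletion F) (a : F) ≠ 0 :=
    (map_ne_zero_iff _ (algebraMap F (w.adicCompletion F)).injective).2 a.ne_zero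
  have hβ' : cohomologyMap β 1 (galoisCohomology.localization (ρ.tateDual n) (Sum.inr w) 1 y) =
      (cohomologyMap (muLocalIso w n).hom 1).hom
        (galoisCohomology.localization (mu F n) (Sum.inr w) 1 (galoisCohomology.map e 1 y)) := by
    rw [localization_map_one_eq]
    obtain ⟨φ, hφ⟩ := oneCocycleClass_surjective _ (galoisCohomology.localization (ρ.tateDual n) (Sum.inr w) 1 y)
    rw [← hφ, cohomologyMap_oneCocycleClass]
    change _ = (cohomologyMap (muLocalIso w n).hom 1).hom
      (galoisCohomology.map (e.restrictField (Place.Completion (Sum.inr w : Place F))) 1 (oneCocycleClass _ φ))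
    rw [galoisCohomology.map_one_oneCocycleClass]
    erw [cohomologyMap_oneCocycleClass]
    refine congrArg _ (Subtype.ext (ContinuousMap.ext fun σ ↦ ?_))
    change muTransfer F (w.adicCompletion F) n (tateDualEval F (ZMod n) n 1 (φ.1 σ)) =
      muTransfer F (w.adicCompletion F) n (e (φ.1 σ))
    rw [tateDualEval_apply, he]
  have hβ : cohomologyMap β 1 (galoisCohomology.localization (ρ.tateDual n) (Sum.inr w) 1 y) =
      Multiplicative.toAdd (kummerMap (w.adicCompletion F) n
        (Units.map (algebraMap F (w.adicCompletion F) : F →* w.adicCompletion F) a)) := by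
    rw [hβ', hy]
    exact cohomologyMap_muLocalIso_localization_kummerMap F w a
  -- read the dual condition through `canonical_w = invLevel ∘ H²(muLocalIso)`, graded commutativity and the transport
  rw [localTatePairingZMod_apply, LocalInvariants.canonical_inr, localInvariantMap_apply] at hval
  have hz : (cohomologyMap (muLocalIso w n).hom 2) (P₁.cupProduct (oneCocycleClass _ tχ)
      (galoisCohomology.localization (ρ.tateDual n) (Sum.inr w) 1 y)) = 0 :=
    (isInvariantMap_invLevel (w.adicCompletion F) n).1.1 (hval.trans (map_zero _).symm)
  -- `[χ·id] ∪' κ = 0` for the flipped pairing; graded commutativity gives `κ ∪ [χ·id] = 0`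
  have hz2 : P.flip.cupProduct (oneCocycleClass _ (scalarCocycle χ))
      (Multiplicative.toAdd (kummerMap (w.adicCompletion F) n
        (Units.map (algebraMap F (w.adicCompletion F) : F →* w.adicCompletion F) a))) = 0 := by
    rw [← hα, ← hβ]
    exact hnat.symm.trans hz
  have hcomm := ContPairing.cupProduct_comm P
    (Multiplicative.toAdd (kummerMap (w.adicCompletion F) n
      (Units.map (algebraMap F (w.adicCompletion F) : F →* w.adicCompletion F) a)))
    (oneCocycleClass _ (scalarCocycle χ))
  have hzero : P.cupProduct (Multiplicative.toAdd (kummerMap (w.adicCompletion F) n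
      (Units.map (algebraMap F (w.adicCompletion F) : F →* w.adicCompletion F) a)))
      (oneCocycleClass _ (scalarCocycle χ)) = 0 := by
    rw [hcomm, neg_eq_zero]
    exact hz2
  have hbr : Multiplicative.toAdd (kummerMap (w.adicCompletion F) n
      (Units.map (algebraMap F (w.adicCompletion F) : F →* w.adicCompletion F) a)) =
      (isSES_kummer (w.adicCompletion F) n (NeZero.pos n)).δ₀
        (baseUnitsInvariant (w.adicCompletion F) (algebraMap F (w.adicCompletion F) (a : F)) ha0) := by
    rw [δ₀_baseUnitsInvariant_eq_toAdd_kummerMap]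
    rfl
  rw [hbr] at hzero
  have hdvd := (cupProduct_δ₀_scalarCocycle_eq_zero_iff_dvd_ord (w.adicCompletion F) χ hIχ hFχ _ ha0).mp hzero
  have hlog := dvd_log_valued_of_dvd_ord F w ha0 hdvd
  rwa [show Valued.v (algebraMap F (w.adicCompletion F) (a : F)) = w.valuation F (a : F) from
    HeightOneSpectrum.valuedAdicCompletion_eq_valuation' w (a : F)] at hlog

end Unramified

/-! ### §2 At a place where `𝓕_w = ⊤`: the dual condition is `loc_w y = 0` -/

section Strict

variable (F : Type) [Field F] [NumberField F] {n : ℕ} [NeZero n]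

/-- **The dual of «everything» is «nothing»**: if `loc_w y ∈ ⊤^⊥` for THE canonical pairing at a finite place `w` (right
non-degeneracy, `canonical_isPerfect`), then `loc_w y = 0`; read through the evaluation `e`, the Kummer class `kummerMap F n a =
H¹(e) y` localises to `0` at `w` — the STRICT hypothesis of p697446 at the places above `v`. [cite: MilneADT2006, Ch. I, Cor. 2.3]
[cite: Howard2004HeegnerKolyvagin, Def. 2.1.6 (arXiv:1202.6340 p. 5)] -/
theorem localization_kummerMap_eq_zero_of_mem_dualLocalCondition_top (ρ : DiscreteGaloisModule F (ZMod n))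
    (e : (ρ.tateDual n).toContRepresentation →ⁱL (mu F n).toContRepresentation)
    (w : HeightOneSpectrum (𝓞 F)) (a : Fˣ) (y : galoisCohomology (ρ.tateDual n) 1)
    (hy : galoisCohomology.map e 1 y = Multiplicative.toAdd (kummerMap F n a))
    (hw : galoisCohomology.localization (ρ.tateDual n) (Sum.inr w) 1 y ∈
      (LocalInvariants.canonical F n).dualLocalCondition ρ (Sum.inr w) ⊤) :
    galoisCohomology.localization (mu F n) (Sum.inr w) 1 (Multiplicative.toAdd (kummerMap F n a)) = 0 := by
  have hM : ∀ m : ZMod n, n • m = 0 := fun m ↦ by rw [nsmul_eq_mul, ZMod.natCast_self, zero_mul]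
  have hinj := ((LocalInvariants.canonical_isPerfect (K := F) (n := n) w).2 ρ hM).2.1
  have h0 : galoisCohomology.localization (ρ.tateDual n) (Sum.inr w) 1 y = 0 := by
    apply hinj
    rw [map_zero]
    refine AddMonoidHom.ext fun t ↦ ?_
    rw [AddMonoidHom.flip_apply, AddMonoidHom.zero_apply]
    exact (LocalInvariants.mem_dualLocalCondition_iff _ _ _ _ _).mp hw t (AddSubgroup.mem_top t)
  have hy2 : (Multiplicative.toAdd (kummerMap F n a) : galoisCohomology (mu F n) 1) = galoisCohomology.map e 1 y :=
    hy.symm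
  rw [hy2, localization_map_one_eq, h0]
  exact map_zero _

end Strict

/-! ### §3 The level square: `H¹(ι^D) y = 0` once the transition `μ_{p^M} ↠ μ_{p^k}` kills `kummerMap F (p^M) a` -/

section LevelSquare

variable (F : Type) [Field F] [CharZero F] {p : ℕ} [hp : Fact p.Prime] {k M : ℕ}

/-- **The level square.** For trivial modules `ρ₀` on `ℤ/p^k` and `ρ` on `ℤ/p^M` (`k ≤ M`), `ι : ℤ/p^k → ℤ/p^M` with
`ι(1) = p^{M−k}`, and the evaluation `e : Hom(ℤ/p^M, μ_{p^M}) → μ_{p^M}`: the evaluation `e₀ : Hom(ℤ/p^k, μ_{p^M}) ⥲ μ_{p^k}`,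
`f ↦ f(1)`, is a BIJECTIVE intertwining map and `e₀ ∘ ι^D = (ζ ↦ ζ^{p^{M−k}}) ∘ e`; hence, `H¹(e₀)` being injective,
`H¹(ι^D) y = 0` as soon as the transition map of `muSystem F` kills `H¹(e) y = kummerMap F (p^M) a` — the conclusion of p697446
`exists_level_red_kummerMap_eq_zero_of_localization_eq_zero`. [cite: SerreGaloisCohomology1997, II §1.2] [cite: MilneADT2006, Ch. I §2] -/
theorem map_tateDualComap_eq_zero_of_red_kummerMap_eq_zero (hkM : k ≤ M)
    (ρ₀ : DiscreteGaloisModule F (ZMod (p ^ k))) (ρ : DiscreteGaloisModule F (ZMod (p ^ M)))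
    (hρ₀ : ∀ (σ : absoluteGaloisGroup F) (m : ZMod (p ^ k)), ρ₀ σ m = m)
    (ι : ρ₀.toContRepresentation →ⁱL ρ.toContRepresentation) (hι : ι 1 = ((p ^ (M - k) : ℕ) : ZMod (p ^ M)))
    (e : (ρ.tateDual (p ^ M)).toContRepresentation →ⁱL (mu F (p ^ M)).toContRepresentation) (he : ∀ f, e f = f 1)
    (y : galoisCohomology (ρ.tateDual (p ^ M)) 1) (a : Fˣ)
    (hy : galoisCohomology.map e 1 y = Multiplicative.toAdd (kummerMap F (p ^ M) a))
    (hred : cohomologyMap ((muSystem F).redHom (n := ⟨p ^ k, pow_pos hp.out.pos k⟩) (m := ⟨p ^ M, pow_pos hp.out.pos M⟩)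
        (pow_dvd_pow p hkM)) 1 (Multiplicative.toAdd (kummerMap F (p ^ M) a)) = 0) :
    galoisCohomology.map (tateDualComap ι) 1 y = 0 := by
  haveI : NeZero (p ^ k) := ⟨pow_ne_zero k hp.out.ne_zero⟩
  haveI : NeZero (p ^ M) := ⟨pow_ne_zero M hp.out.ne_zero⟩
  -- `f 1` is killed by `p^k` for `f ∈ Hom(ℤ/p^k, μ_{p^M})`
  have hpow : ∀ f : TateDual F (ZMod (p ^ k)) (p ^ M), muVal F (p ^ M) (f 1) ^ p ^ k = 1 := fun f ↦ by
    have h1 : (p ^ k) • f 1 = 0 := by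
      rw [← map_nsmul, nsmul_eq_mul, mul_one, ZMod.natCast_self, map_zero]
    have h2 := muVal_nsmul F (p ^ M) (p ^ k) (f 1)
    erw [h1] at h2
    exact h2.symm.trans (muVal_zero F (p ^ M))
  -- homs out of `ℤ/p^k` are determined by their value at `1`
  have hdet : ∀ (f : TateDual F (ZMod (p ^ k)) (p ^ M)) (x : ZMod (p ^ k)),
      (f x : MuCarrier F (p ^ M)) = x.val • (f 1 : MuCarrier F (p ^ M)) := fun f x ↦ by
    conv_lhs => rw [← ZMod.natCast_zmod_val x, ← nsmul_one]
    exact map_nsmul f x.val 1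
  -- the evaluation `e₀ : Hom(ℤ/p^k, μ_{p^M}) → μ_{p^k}`
  let e₀fun : TateDual F (ZMod (p ^ k)) (p ^ M) → MuCarrier F (p ^ k) := fun f ↦
    muOfUnit F (p ^ k) (muVal F (p ^ M) (f 1)) (hpow f)
  have he₀val : ∀ f, muVal F (p ^ k) (e₀fun f) = muVal F (p ^ M) (f 1) := fun f ↦ muVal_muOfUnit F (p ^ k) _ _
  let e₀add : TateDual F (ZMod (p ^ k)) (p ^ M) →+ MuCarrier F (p ^ k) :=
    { toFun := e₀fun
      map_zero' := muVal_injective F (p ^ k) (by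
        rw [he₀val, TateDual.zero_apply]
        exact (muVal_zero F (p ^ M)).trans (muVal_zero F (p ^ k)).symm)
      map_add' := fun f g ↦ muVal_injective F (p ^ k) (by
        rw [he₀val, muVal_add, he₀val, he₀val, TateDual.add_apply]
        exact muVal_add F (p ^ M) (f 1) (g 1)) }
  let e₀ : (ρ₀.tateDual (p ^ M)).toContRepresentation →ⁱL (mu F (p ^ k)).toContRepresentation :=
    { toContinuousLinearMap := ⟨e₀add.toIntLinearMap, continuous_of_discreteTopology⟩
      isIntertwining' := fun σ ↦ ContinuousLinearMap.ext fun f ↦ muVal_injective F (p ^ k) (by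
        change muVal F (p ^ k) (e₀fun ((ρ₀.tateDual (p ^ M)) σ f)) = muVal F (p ^ k) (mu F (p ^ k) σ (e₀fun f))
        rw [he₀val, muVal_apply, he₀val, tateDual_apply_apply_apply, hρ₀, muVal_apply]) }
  have he₀ : ∀ f, muVal F (p ^ k) (e₀ f) = muVal F (p ^ M) (f 1) := he₀val
  -- `e₀` is bijective
  have hbij : Function.Bijective e₀ := by
    refine ⟨fun f g hfg ↦ TateDual.ext fun x ↦ ?_, fun ζ ↦ ?_⟩
    · have h1 : f 1 = g 1 := muVal_injective F (p ^ M) (by rw [← he₀, ← he₀, hfg])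
      change (f x : MuCarrier F (p ^ M)) = (g x : MuCarrier F (p ^ M))
      rw [hdet f x, hdet g x]
      exact congrArg _ h1
    · -- the preimage of `ζ`: `x ↦ x • ζ` read in `μ_{p^M}`
      have hζ : muVal F (p ^ k) ζ ^ p ^ M = 1 := by
        obtain ⟨d, hd⟩ := pow_dvd_pow p hkM
        rw [hd, pow_mul, muVal_pow_eq_one, one_pow]
      let ζ' : MuCarrier F (p ^ M) := muOfUnit F (p ^ M) (muVal F (p ^ k) ζ) hζ
      have hζ' : (p ^ k) • ζ' = 0 := muVal_injective F (p ^ M) (by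
        rw [muVal_nsmul, muVal_muOfUnit, muVal_pow_eq_one, muVal_zero])
      let f : ZMod (p ^ k) →+ MuCarrier F (p ^ M) :=
        ZMod.lift (p ^ k) ⟨zmultiplesHom _ ζ', by rw [zmultiplesHom_apply, natCast_zsmul, hζ']⟩
      refine ⟨(f : TateDual F (ZMod (p ^ k)) (p ^ M)), muVal_injective F (p ^ k) ?_⟩
      have hf1 : (f 1 : MuCarrier F (p ^ M)) = ζ' := by
        rw [← Int.cast_one (R := ZMod (p ^ k)), ZMod.lift_coe]
        exact one_zsmul ζ'
      rw [he₀]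
      change muVal F (p ^ M) (f 1) = _
      rw [hf1, muVal_muOfUnit]
  -- the square `e₀ ∘ ι^D = red ∘ e` on `H¹`
  have hsq : galoisCohomology.map e₀ 1 (galoisCohomology.map (tateDualComap ι) 1 y) =
      cohomologyMap ((muSystem F).redHom (n := ⟨p ^ k, pow_pos hp.out.pos k⟩) (m := ⟨p ^ M, pow_pos hp.out.pos M⟩)
        (pow_dvd_pow p hkM)) 1 (galoisCohomology.map e 1 y) := by
    obtain ⟨φ, rfl⟩ := oneCocycleClass_surjective _ y
    rw [galoisCohomology.map_one_oneCocycleClass, galoisCohomology.map_one_oneCocycleClass,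
      galoisCohomology.map_one_oneCocycleClass]
    erw [cohomologyMap_oneCocycleClass]
    refine congrArg _ (Subtype.ext (ContinuousMap.ext fun σ ↦ muVal_injective F (p ^ k) ?_))
    change muVal F (p ^ k) (e₀ (tateDualComap ι (φ.1 σ))) =
      muVal F (p ^ k) (muPowMap F (pow_dvd_pow p hkM : p ^ k ∣ p ^ M) (e (φ.1 σ)))
    have h1 : muVal F (p ^ M) ((φ.1 σ) (ι 1)) = muVal F (p ^ M) ((φ.1 σ) 1) ^ p ^ (M - k) := by
      rw [hι, ← nsmul_one, map_nsmul]
      exact muVal_nsmul F (p ^ M) (p ^ (M - k)) ((φ.1 σ) 1)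
    rw [he₀, tateDualComap_apply_apply, h1, muVal_muPowMap, he, Nat.pow_div hkM hp.out.pos]
  have hinj := (Summit.BirchSwinnertonDyer.Rank1Residual.GaloisImage.Transport.map_bijective_of_inverse e₀
    (Summit.BirchSwinnertonDyer.Rank1Residual.GaloisImage.Transport.inverseOfBijective e₀ hbij)
    (Summit.BirchSwinnertonDyer.Rank1Residual.GaloisImage.Transport.inverseOfBijective_apply e₀ hbij)
    (Summit.BirchSwinnertonDyer.Rank1Residual.GaloisImage.Transport.apply_inverseOfBijective e₀ hbij)).1
  apply hinj
  rw [map_zero, hsq, hy]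
  exact hred

end LevelSquare

/-! ### §4 (PRO-NULL) for the trivial cyclic levels: `ProNullLift`'s `hkill` -/

section Assembly

variable {K : Type} [Field K] [NumberField K] {p : ℕ} [hp : Fact p.Prime]

/-- **(PRO-NULL), θ = 1.** Let `K` be imaginary quadratic, `p = v v̄` split (`v ≠ v̄`), `F/K` finite ABELIAN (a layer `K*_n`
of a `ℤ_p`-extension, say). For every `k` there is `M ≥ k` such that: for all trivial discrete `Γ_F`-modules `ρ₀` on `ℤ/p^k`
and `ρ` on `ℤ/p^M`, every intertwining `ι` with `ι(1) = p^{M−k}`, and every Selmer structure `𝓕` on `ρ` which is `⊤` at the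
places above `v` and `H¹_ur` at every other finite place, THE canonical dual Selmer group `H¹_{𝓕^*}(F, ρ^D)` is KILLED by
`H¹(ι^D) : H¹(F, ρ^D) → H¹(F, ρ₀^D)` — the hypothesis `hkill` of `ProNullLift.exists_selmer_sub_localMap_mem_canonical_of_
dualPullback_eq_zero` for these levels. Proof: `y ↦ a ∈ F^×` with `H¹(e) y = κ_{p^M}(a)` (Kummer surjectivity); §1 at the
finite `w ∤ v` and §2 at `w ∣ v` give the hypotheses of (R1) in `H¹`-currency (p697446), whose conclusion feeds §3.
[cite: SerreGaloisCohomology1997, II §1.2] [cite: deShalit1987, III.2.3 (Theorem (Baker–Brumer))] [cite: MilneADT2006, Ch. I, Thm. 4.10 (b)] -/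
theorem proNull_canonical_of_trivial (hK : IsImaginaryQuadratic K) {v vbar : HeightOneSpectrum (𝓞 K)}
    (hv : ((p : ℕ) : 𝓞 K) ∈ v.asIdeal) (hvbar : ((p : ℕ) : 𝓞 K) ∈ vbar.asIdeal) (hne : vbar ≠ v)
    (F : IntermediateField K (AlgebraicClosure K)) [FiniteDimensional K F] [IsAbelianGalois K F] [NumberField F] (k : ℕ) :
    ∃ M : ℕ, k ≤ M ∧ ∀ (ρ₀ : DiscreteGaloisModule F (ZMod (p ^ k))) (ρ : DiscreteGaloisModule F (ZMod (p ^ M)))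
      (_hρ₀ : ∀ (σ : absoluteGaloisGroup F) (m : ZMod (p ^ k)), ρ₀ σ m = m)
      (_hρ : ∀ (σ : absoluteGaloisGroup F) (m : ZMod (p ^ M)), ρ σ m = m)
      (ι : ρ₀.toContRepresentation →ⁱL ρ.toContRepresentation) (_hι : ι 1 = ((p ^ (M - k) : ℕ) : ZMod (p ^ M)))
      (𝓕 : SelmerStructure ρ)
      (_h𝓕v : ∀ w : HeightOneSpectrum (𝓞 F), w.under (𝓞 K) = v → 𝓕 (Sum.inr w) = ⊤)
      (_h𝓕 : ∀ w : HeightOneSpectrum (𝓞 F), w.under (𝓞 K) ≠ v →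
        𝓕 (Sum.inr w) = unramifiedSubgroup (GaloisRep.toLocal w ρ) 1),
      haveI : NeZero (p ^ M) := ⟨pow_ne_zero M hp.out.ne_zero⟩
      ∀ y ∈ ((LocalInvariants.canonical F (p ^ M)).dualSelmerStructure ρ 𝓕).selmerGroup,
        galoisCohomology.map (tateDualComap ι) 1 y = 0 := by
  obtain ⟨M, hkM, hM⟩ := exists_level_red_kummerMap_eq_zero_of_localization_eq_zero (p := p) hK hv hvbar hne F k
  refine ⟨M, hkM, fun ρ₀ ρ hρ₀ hρ ι hι 𝓕 h𝓕v h𝓕 y hy ↦ ?_⟩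
  haveI : NeZero (p ^ M) := ⟨pow_ne_zero M hp.out.ne_zero⟩
  haveI : NeZero (p ^ k) := ⟨pow_ne_zero k hp.out.ne_zero⟩
  haveI : NeZero ((p ^ M : ℕ) : F) := ⟨by exact_mod_cast pow_ne_zero M hp.out.ne_zero⟩
  obtain ⟨e, he⟩ := exists_contIntertwiningMap_tateDual_eval ρ hρ
  obtain ⟨a, ha⟩ := kummerMap_surjective F (p ^ M) (Multiplicative.ofAdd (galoisCohomology.map e 1 y))
  have hy' : galoisCohomology.map e 1 y = Multiplicative.toAdd (kummerMap F (p ^ M) a) := by rw [ha]; rfl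
  have hloc := (SelmerStructure.mem_selmerGroup_iff _ _).mp hy
  have hdiv : ∀ w : HeightOneSpectrum (𝓞 F), w.under (𝓞 K) ≠ v →
      ((p ^ M : ℕ) : ℤ) ∣ WithZero.log (w.valuation F (a : F)) := fun w hw ↦ by
    have h := hloc (Sum.inr w)
    rw [LocalInvariants.dualSelmerStructure_apply, h𝓕 w hw] at h
    exact dvd_log_valuation_of_mem_dualLocalCondition_unramifiedSubgroup F ρ hρ e he w a y hy' h
  have hstrict : ∀ w : v.Extension (𝓞 F),
      galoisCohomology.localization (mu F (p ^ M)) (Sum.inr w.1) 1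
        (Multiplicative.toAdd (kummerMap F (p ^ M) a)) = 0 := fun w ↦ by
    have h := hloc (Sum.inr w.1)
    rw [LocalInvariants.dualSelmerStructure_apply, h𝓕v w.1 w.2] at h
    exact localization_kummerMap_eq_zero_of_mem_dualLocalCondition_top F ρ e w.1 a y hy' h
  have hred := hM a hdiv hstrict (pow_dvd_pow p hkM)
  exact map_tateDualComap_eq_zero_of_red_kummerMap_eq_zero F hkM ρ₀ ρ hρ₀ ι hι e he y a hy' hred

end Assembly

end Summit.BirchSwinnertonDyer.BirchSwinnertonDyer.Theorems.PrintCf2.KummerProNull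

end
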